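import Summits.NavierStokesRegularity.NavierStokesRegularity.Theorems.TypeICertificateLadderTargetFlowwiseDepletionSlice
import HarnessLib

/-!
# Route `ExtremiserTransience`, LINE g4-α «per-flow-tangent» (ns-idea-5 g4): the enstrophy slice IDENTITY (no Young step)

`--supports stmt-NavierStokesRegularity-26568` (`TangentExtremalExtraction`; first file of the Lean plan for stub S1
`stub_lockedTimes_logDensity` of skeleton v3c, BC-RECORD 10:20Z).

The landed `DepletionLadder.depleted_enstrophy_slice_of_bound` proves `∫⟪ω, curl W⟫ ≤ (κ²M²/(4ν))‖ω‖₂²` by the identity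
`∫⟪ω, curl W⟫ = −ν‖∇ω‖₂² + ∫⟪ω, Dv ω⟫` followed by Young's inequality, which discards the information WHERE the dissipation
`ν‖∇ω‖₂²` sits relative to the production.  The dynamic proof of the scale lock (growth-carrying times are locked) needs the
identity itself:

* `enstrophy_slice_eq` — `v` smooth divergence free, `|v| ≤ M`, `‖Dv‖ ≤ B`, `Dv, D²v, D³v ∈ L²`,
  `curl W = νΔω − (v·∇)ω + (ω·∇)v` ⟹ `∫⟪curl v, curl W⟫ = −ν ∫|∇ curl v|²_F + ∫⟪curl v, Dv curl v⟫`
  (proof verbatim the landed one, stopping before Young);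
* `enstrophy_slice_le_of_coeff` — with a slice depletion bound `|∫⟪ω, Dv ω⟫| ≤ k·M·‖ω‖₂·‖∇ω‖₂` the un-optimised inequality
  `∫⟪curl v, curl W⟫ ≤ k M ‖ω‖₂‖∇ω‖₂ − ν‖∇ω‖₂²`, and its consequence used by the lock: if moreover
  `η·Z ≤ 2(T−t)·∫⟪curl v, curl W⟫` (`Ż ≥ ηZ/(T−t)`, growth-carrying slice) then `η Z ≤ 2(T−t) k M ‖ω‖₂‖∇ω‖₂`, whence
  `Z ≤ (2kM(T−t)/η)² · ‖∇ω‖₂²`-type locks (`lock_of_growth`).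
HONEST FRAMING: nothing about Navier–Stokes regularity or blow-up is proved. [folklore]
References: P. G. Lemarié-Rieusset (2016), §11.6, Thm. 11.2; Robinson–Rodrigo–Sadowski (2016), Lemma 8.16. [folklore]
-/

noncomputable section

open Set Filter Topology MeasureTheory
open scoped RealInnerProductSpace ENNReal NNReal Laplacian ContDiff
open Literature.Analysis.FluidPDE

namespace Summit.NavierStokesRegularity.NavierStokesRegularity.Theorems.DepletionLadder.PerFlow

set_option linter.dupNamespace false
set_option linter.style.longLine false

open Summit.NavierStokesRegularity.NavierStokesRegularity.Theorems.RungReynoldsOne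
open Summit.NavierStokesRegularity.NavierStokesRegularity.Theorems.RungReynoldsOne.WeightedSlice

/-- **The enstrophy slice identity** `∫⟪ω, curl W⟫ = −ν‖∇ω‖₂² + ∫⟪ω, Dv ω⟫` (viscosity `enstrophy_viscous`, transport `0`
by `enstrophy_transport`). [folklore] -/
theorem enstrophy_slice_eq {ν : ℝ}
    {v W : EuclideanSpace ℝ (Fin 3) → EuclideanSpace ℝ (Fin 3)} (hv : ContDiff ℝ ∞ v)
    (hdiv : VectorCalculus.IsDivFree v)
    (hcurl : ∀ x, curl W x = ν • (Δ (curl v)) x - convect v (curl v) x + convect (curl v) v x)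
    {M B : ℝ} (hM : ∀ x, ‖v x‖ ≤ M) (hB : ∀ x, ‖fderiv ℝ v x‖ ≤ B)
    (h1 : ∫⁻ x, ‖iteratedFDeriv ℝ 1 v x‖ₑ ^ 2 < ⊤) (h2 : ∫⁻ x, ‖iteratedFDeriv ℝ 2 v x‖ₑ ^ 2 < ⊤)
    (h3 : ∫⁻ x, ‖iteratedFDeriv ℝ 3 v x‖ₑ ^ 2 < ⊤) :
    ∫ x, ⟪curl v x, curl W x⟫ =
      -(ν * ∫ x, frobeniusNormSq (fderiv ℝ (curl v) x)) + ∫ x, ⟪curl v x, fderiv ℝ v x (curl v x)⟫ := by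
  set e := EuclideanSpace.basisFun (Fin 3) ℝ with he
  have he1 : ∀ i, ‖e i‖ = 1 := fun i => by simp [he]
  -- smoothness of the vorticity
  have hDv : ContDiff ℝ ∞ (fderiv ℝ v) := (contDiff_infty_iff_fderiv.1 hv).2
  have hω : ContDiff ℝ ∞ (curl v) := by
    rw [curl_eq_curlCLM_comp]
    exact curlCLM.contDiff.comp hDv
  have hω2 : ContDiff ℝ 2 (curl v) := hω.of_le (by norm_cast)
  have hω1 : ContDiff ℝ 1 (curl v) := hω.of_le (by norm_cast)
  have hv1 : ContDiff ℝ 1 v := hv.of_le (by norm_cast)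
  have hv2 : ContDiff ℝ 2 v := hv.of_le (by norm_cast)
  have cv : Continuous v := hv.continuous
  have cω : Continuous (curl v) := hω.continuous
  -- the vorticity equation with `convect` unfolded
  have hZ : ∀ x, curl W x =
      ν • (Δ (curl v)) x - fderiv ℝ (curl v) x (v x) + fderiv ℝ v x (curl v x) := hcurl
  -- `ω, ∂ᵢω, ∂ᵢ∂ᵢω ∈ L²`
  have l2ω : ∫⁻ x, ‖curl v x‖ₑ ^ 2 < ⊤ := by
    refine lintegral_enorm_sq_lt_top_of_norm_le_const_mul ‖curlCLM‖ (fun x => ?_) h1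
    rw [← norm_iteratedFDeriv_fderiv, norm_iteratedFDeriv_zero]
    exact norm_curl_le v x
  have l2dω : ∀ i, ∫⁻ x, ‖fderiv ℝ (curl v) x (e i)‖ₑ ^ 2 < ⊤ := fun i => by
    refine lintegral_enorm_sq_lt_top_of_norm_le_const_mul ‖curlCLM‖ (fun x => ?_) h2
    calc ‖fderiv ℝ (curl v) x (e i)‖ ≤ ‖fderiv ℝ (curl v) x‖ := by
          simpa [he1] using (fderiv ℝ (curl v) x).le_opNorm (e i)
      _ ≤ ‖curlCLM‖ * ‖iteratedFDeriv ℝ 2 v x‖ := norm_fderiv_curl_le hv2 x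
  have l2ddω : ∀ i, ∫⁻ x, ‖fderiv ℝ (fun y => fderiv ℝ (curl v) y (e i)) x (e i)‖ₑ ^ 2 < ⊤ :=
      fun i => by
    refine lintegral_enorm_sq_lt_top_of_norm_le_const_mul ‖curlCLM‖ (fun x => ?_) h3
    calc ‖fderiv ℝ (fun y => fderiv ℝ (curl v) y (e i)) x (e i)‖
        ≤ ‖iteratedFDeriv ℝ 2 (curl v) x‖ := norm_fderiv_fderiv_apply_basisFun_le hω2 x i
      _ ≤ ‖curlCLM‖ * ‖iteratedFDeriv ℝ 3 v x‖ := by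
          rw [curl_eq_curlCLM_comp, curlCLM.iteratedFDeriv_comp_left (hDv.contDiffAt (x := x))
            (i := 2) (by norm_cast), ← norm_iteratedFDeriv_fderiv]
          exact ContinuousLinearMap.norm_compContinuousMultilinearMap_le _ _
  -- the three terms
  obtain ⟨iLap, iFrob, hVisc⟩ := enstrophy_viscous hω2 l2ω l2dω l2ddω
  obtain ⟨iTr, hTr⟩ := enstrophy_transport hv1 hω2 hdiv hM hB l2ω l2dω
  have iStr : Integrable (fun x => ⟪curl v x, fderiv ℝ v x (curl v x)⟫) volume := by
    refine integrable_of_norm_le_const_mul_mul B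
      (cω.inner ((hv1.continuous_fderiv one_ne_zero).clm_apply cω)) cω cω l2ω l2ω fun x => ?_
    calc ‖⟪curl v x, fderiv ℝ v x (curl v x)⟫‖ ≤ ‖curl v x‖ * ‖fderiv ℝ v x (curl v x)‖ :=
          norm_inner_le_norm _ _
      _ ≤ ‖curl v x‖ * (B * ‖curl v x‖) :=
          mul_le_mul_of_nonneg_left ((fderiv ℝ v x).le_of_opNorm_le (hB x) _) (norm_nonneg _)
      _ = B * ‖curl v x‖ * ‖curl v x‖ := by ring
  set Z : ℝ := ∫ x, ‖curl v x‖ ^ 2 with hZdef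
  set A : ℝ := ∫ x, frobeniusNormSq (fderiv ℝ (curl v) x) with hAdef
  set J : ℝ := ∫ x, ⟪curl v x, fderiv ℝ v x (curl v x)⟫ with hJdef
  have hZ0 : 0 ≤ Z := integral_nonneg fun x => sq_nonneg _
  have hA0 : 0 ≤ A := integral_nonneg fun x => frobeniusNormSq_nonneg _
  -- pointwise decomposition of the integrand
  have hfun : (fun x => ⟪curl v x, curl W x⟫) = fun x =>
      ν * ⟪(Δ (curl v)) x, curl v x⟫ - ⟪curl v x, fderiv ℝ (curl v) x (v x)⟫ +
        ⟪curl v x, fderiv ℝ v x (curl v x)⟫ := by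
    funext x
    have hc : ⟪curl v x, ν • (Δ (curl v)) x⟫ = ν * ⟪(Δ (curl v)) x, curl v x⟫ := by
      rw [real_inner_smul_right, real_inner_comm]
    rw [hZ x, inner_add_right, inner_sub_right, hc]
  have iAB : Integrable (fun x => ν * ⟪(Δ (curl v)) x, curl v x⟫ -
      ⟪curl v x, fderiv ℝ (curl v) x (v x)⟫) volume := (iLap.const_mul ν).sub iTr
  rw [hfun, integral_add iAB iStr, integral_sub (iLap.const_mul ν) iTr, integral_const_mul, hVisc,
    hTr, sub_zero]
  ring

/-- **Un-optimised depleted slice inequality**: with a slice depletion coefficient `k`,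
`∫⟪curl v, curl W⟫ ≤ k·M·‖ω‖₂·‖∇ω‖₂ − ν‖∇ω‖₂²`. [folklore] -/
theorem enstrophy_slice_le_of_coeff {ν k : ℝ}
    {v W : EuclideanSpace ℝ (Fin 3) → EuclideanSpace ℝ (Fin 3)} (hv : ContDiff ℝ ∞ v)
    (hdiv : VectorCalculus.IsDivFree v)
    (hcurl : ∀ x, curl W x = ν • (Δ (curl v)) x - convect v (curl v) x + convect (curl v) v x)
    {M B : ℝ} (hM : ∀ x, ‖v x‖ ≤ M) (hB : ∀ x, ‖fderiv ℝ v x‖ ≤ B)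
    (h1 : ∫⁻ x, ‖iteratedFDeriv ℝ 1 v x‖ₑ ^ 2 < ⊤) (h2 : ∫⁻ x, ‖iteratedFDeriv ℝ 2 v x‖ₑ ^ 2 < ⊤)
    (h3 : ∫⁻ x, ‖iteratedFDeriv ℝ 3 v x‖ₑ ^ 2 < ⊤)
    (hJ : |∫ x, ⟪curl v x, fderiv ℝ v x (curl v x)⟫| ≤
      k * M * Real.sqrt (∫ x, ‖curl v x‖ ^ 2) *
        Real.sqrt (∫ x, frobeniusNormSq (fderiv ℝ (curl v) x))) :
    ∫ x, ⟪curl v x, curl W x⟫ ≤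
      k * M * Real.sqrt (∫ x, ‖curl v x‖ ^ 2) * Real.sqrt (∫ x, frobeniusNormSq (fderiv ℝ (curl v) x))
        - ν * ∫ x, frobeniusNormSq (fderiv ℝ (curl v) x) := by
  rw [enstrophy_slice_eq hv hdiv hcurl hM hB h1 h2 h3]
  linarith [le_abs_self (∫ x, ⟪curl v x, fderiv ℝ v x (curl v x)⟫)]

/-- **Lock from growth** (the slice step of S1): on a growth-carrying slice, `η·Z ≤ 2(T−t)·∫⟪curl v, curl W⟫` with
`η > 0`, `T − t > 0`, the slice coefficient bound `k·M ≤ A/√(T−t)` (`k ≤ κ⋆`, Type-I `M√(T−t) ≤ C√ν`, `A = κ⋆C√ν`) gives the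
UPPER LOCK `Z ≤ (4A²/η²)·(T−t)·‖∇ω‖₂²`; with `A² = κ⋆²C²ν` this is `Z ≤ (4κ⋆²C²/η²)·ν(T−t)·P`. [folklore] -/
theorem lock_of_growth {ν k η T t A : ℝ} (hν : 0 ≤ ν) (hη : 0 < η) (hTt : 0 < T - t)
    {v W : EuclideanSpace ℝ (Fin 3) → EuclideanSpace ℝ (Fin 3)} (hv : ContDiff ℝ ∞ v)
    (hdiv : VectorCalculus.IsDivFree v)
    (hcurl : ∀ x, curl W x = ν • (Δ (curl v)) x - convect v (curl v) x + convect (curl v) v x)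
    {M B : ℝ} (hM : ∀ x, ‖v x‖ ≤ M) (hB : ∀ x, ‖fderiv ℝ v x‖ ≤ B)
    (h1 : ∫⁻ x, ‖iteratedFDeriv ℝ 1 v x‖ₑ ^ 2 < ⊤) (h2 : ∫⁻ x, ‖iteratedFDeriv ℝ 2 v x‖ₑ ^ 2 < ⊤)
    (h3 : ∫⁻ x, ‖iteratedFDeriv ℝ 3 v x‖ₑ ^ 2 < ⊤)
    (hJ : |∫ x, ⟪curl v x, fderiv ℝ v x (curl v x)⟫| ≤
      k * M * Real.sqrt (∫ x, ‖curl v x‖ ^ 2) *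
        Real.sqrt (∫ x, frobeniusNormSq (fderiv ℝ (curl v) x)))
    (hkM : k * M * Real.sqrt (T - t) ≤ A)
    (hgrowth : η * ∫ x, ‖curl v x‖ ^ 2 ≤ 2 * (T - t) * ∫ x, ⟪curl v x, curl W x⟫) :
    ∫ x, ‖curl v x‖ ^ 2 ≤ (4 * A ^ 2 / η ^ 2) * (T - t) * ∫ x, frobeniusNormSq (fderiv ℝ (curl v) x) := by
  set Z : ℝ := ∫ x, ‖curl v x‖ ^ 2 with hZ
  set P : ℝ := ∫ x, frobeniusNormSq (fderiv ℝ (curl v) x) with hP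
  have hZ0 : 0 ≤ Z := integral_nonneg fun x => sq_nonneg _
  have hP0 : 0 ≤ P := integral_nonneg fun x => frobeniusNormSq_nonneg _
  have hM0 : 0 ≤ M := (norm_nonneg _).trans (hM 0)
  have hsl := enstrophy_slice_le_of_coeff hv hdiv hcurl hM hB h1 h2 h3 hJ
  -- `η Z ≤ 2(T−t)(kM√Z√P − νP) ≤ 2(T−t) k M √Z √P`
  have hst : η * Z ≤ 2 * (T - t) * (k * M * Real.sqrt Z * Real.sqrt P) := by
    have h := hgrowth.trans (mul_le_mul_of_nonneg_left hsl (by positivity))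
    nlinarith [mul_nonneg (mul_nonneg (by positivity : (0:ℝ) ≤ 2 * (T - t)) hν) hP0]
  -- `k M (T−t) = (k M √(T−t)) √(T−t) ≤ A √(T−t)`
  set s : ℝ := Real.sqrt (T - t) with hs
  have hs0 : 0 ≤ s := Real.sqrt_nonneg _
  have hsT : s ^ 2 = T - t := by rw [hs]; exact Real.sq_sqrt hTt.le
  have hkMT : 2 * (T - t) * (k * M * Real.sqrt Z * Real.sqrt P) ≤ 2 * A * s * Real.sqrt Z * Real.sqrt P := by
    have heq : 2 * (T - t) * (k * M * Real.sqrt Z * Real.sqrt P)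
        = 2 * (k * M * s) * s * Real.sqrt Z * Real.sqrt P := by rw [← hsT]; ring
    rw [heq]
    have hnn : 0 ≤ s * Real.sqrt Z * Real.sqrt P := by positivity
    nlinarith [mul_le_mul_of_nonneg_right hkM hnn]
  have hkey : η * Z ≤ 2 * A * s * Real.sqrt Z * Real.sqrt P := hst.trans hkMT
  -- square: `η √Z ≤ 2A√(T−t)√P`, so `η² Z ≤ 4A²(T−t)P`
  have hZs : Real.sqrt Z ^ 2 = Z := Real.sq_sqrt hZ0
  have hPs : Real.sqrt P ^ 2 = P := Real.sq_sqrt hP0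
  have hη2 : 0 < η ^ 2 := by positivity
  rw [div_mul_eq_mul_div, div_mul_eq_mul_div, le_div_iff₀ hη2]
  -- goal: Z * η^2 ≤ 4 A^2 (T−t) P
  rcases hZ0.lt_or_eq with hZpos | hZzero
  · have hsZ : 0 < Real.sqrt Z := Real.sqrt_pos.2 hZpos
    have h' : η * Real.sqrt Z ≤ 2 * A * s * Real.sqrt P := by
      have := hkey
      rw [← hZs] at this
      nlinarith [hsZ, this]
    have h'' := pow_le_pow_left₀ (by positivity) h' 2
    calc Z * η ^ 2 = (η * Real.sqrt Z) ^ 2 := by rw [mul_pow, hZs]; ring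
      _ ≤ (2 * A * s * Real.sqrt P) ^ 2 := h''
      _ = 4 * A ^ 2 * (T - t) * P := by rw [mul_pow, mul_pow, mul_pow, hsT, hPs]; ring
  · rw [← hZzero, zero_mul]; positivity

end Summit.NavierStokesRegularity.NavierStokesRegularity.Theorems.DepletionLadder.PerFlow

end
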